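import Summits.CriticalPhenomena.PercolationContinuityZ3.Theorems.PercNearOneGluingNoHeavyLowerTailKNGoodPortFree
import HarnessLib

/-!
# Affinity of the goodness functional in a hair of the SURE TWIN of the observer
# (`NoHeavyLowerTail` cell, stmt-CriticalPhenomena-4575; prover `prim-hp-2`, deletion–contraction line, gen 12)

Support file (`--supports stmt-CriticalPhenomena-4575`).  No definitions, no named facts, no sorries.
Memo: `run/shared/lean/prim/prim-hp-2/MEMO-gen12-gc-three-relays.md` §5 (assembly plan for the three-relay GC, step (i)).

In the gluing inequality `hGC` of `KNGoodSeries.knGood_series_of_gluing` the observer `x` is joined to its sibling `y` by a SURE pair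
`s(x,y)`; the hairs of `y` are then hairs of the merged star, and the goodness functional
`agood(u, x; j) := μ_u(x ↔ b) − μ_u(j ↔ b) + Σ_{W ∩ A = ∅} μ_u(C(x) = W)·min_{a∈A} μ_u(a ↔ b off W)`
is AFFINE in each of them, exactly as in a hair of `x` itself (`KNGoodSeries.agood_affine_pair`):

* `KNGoodGC3.agood_affine_pair_twin` — for `u s(x,y) = 1`, `q ∉ {x,y}` and `e = s(y,q)`:
  `agood(u[e↦t], x; j) = (1 − t)·agood(u[e↦0], x; j) + t·agood(u[e↦1], x; j)`.
  Proof: every probability is affine in the weight of `e` (one-bond decomposition); the pockets `W ∌ y` are null because `s(x,y)` is sure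
  (`KNGoodPortFree.real_clusterIs_update_one_eq_zero`), and for `W ∋ y` the minima `min_a μ(a ↔ b off W)` do not feel `e`
  (`KNGoodHair.preimage_insert_openConnIn_eq`).
This is the first step of the multi-affine (corner) expansion of the merged two-star observer in all six hairs.
[cite: KozmaNitzan2024, §3.2 Definition (p. 12), proof of Thm. 5 (pp. 13–14)]
-/

noncomputable section

namespace Summit.CriticalPhenomena.PercolationContinuityZ3.Theorems

open MeasureTheory Set Literature.Probability.LatticeModels Literature.Probability.Percolation
open scoped Classical BigOperators

variable {n : ℕ}

namespace KNGoodGC3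

open ChampionStability KNGoodAux KNGoodHair KNGoodSeries KNGoodPortFree

/-- **Affinity of the goodness functional in a hair of the sure twin.**  `x ≠ y`, `q ≠ x`, `u s(x,y) = 1`, `e = s(y,q)`:
`agood(u[e↦t], x; j) = (1 − t)·agood(u[e↦0], x; j) + t·agood(u[e↦1], x; j)`.
[cite: KozmaNitzan2024, §3.2 Definition (p. 12); folklore (one-bond decomposition)] -/
theorem agood_affine_pair_twin (u : Sym2 (Fin n) → unitInterval) (A : Finset (Fin n)) (hA : A.Nonempty)
    (x y q j b : Fin n) (hxy : x ≠ y) (hqx : q ≠ x) (hsure : u s(x, y) = 1) (t : unitInterval) :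
    (prodBernoulli (Function.update u s(y, q) t)).real (openConn x b) -
        (prodBernoulli (Function.update u s(y, q) t)).real (openConn j b) +
        ∑ W ∈ nullSets A, (prodBernoulli (Function.update u s(y, q) t)).real (clusterIs x W) *
          A.inf' hA (fun a' => (prodBernoulli (Function.update u s(y, q) t)).real (openConnIn ((↑W : Set (Fin n))ᶜ) a' b)) =
      (1 - (t : ℝ)) * ((prodBernoulli (Function.update u s(y, q) 0)).real (openConn x b) -
        (prodBernoulli (Function.update u s(y, q) 0)).real (openConn j b) +
        ∑ W ∈ nullSets A, (prodBernoulli (Function.update u s(y, q) 0)).real (clusterIs x W) *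
          A.inf' hA (fun a' => (prodBernoulli (Function.update u s(y, q) 0)).real (openConnIn ((↑W : Set (Fin n))ᶜ) a' b))) +
      (t : ℝ) * ((prodBernoulli (Function.update u s(y, q) 1)).real (openConn x b) -
        (prodBernoulli (Function.update u s(y, q) 1)).real (openConn j b) +
        ∑ W ∈ nullSets A, (prodBernoulli (Function.update u s(y, q) 1)).real (clusterIs x W) *
          A.inf' hA (fun a' => (prodBernoulli (Function.update u s(y, q) 1)).real (openConnIn ((↑W : Set (Fin n))ᶜ) a' b))) := by
  set e : Sym2 (Fin n) := s(y, q) with he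
  set μ0 := prodBernoulli (Function.update u e 0) with hμ0
  set μ1 := prodBernoulli (Function.update u e 1) with hμ1
  have hexy : s(x, y) ≠ e := by
    rw [he]; intro h
    rcases Sym2.eq_iff.1 h with ⟨h1, _⟩ | ⟨h1, _⟩
    · exact hxy h1
    · exact hqx h1.symm
  have hdec : ∀ (t' : unitInterval) (S : Set (BondConfig (Fin n))),
      (prodBernoulli (Function.update u e t')).real S = (1 - (t' : ℝ)) * μ0.real S + (t' : ℝ) * μ1.real S := by
    intro t' S
    have h := stub_oneBondDecomp_k15 n (Function.update u e t') e S
    rwa [Function.update_idem, Function.update_idem, Function.update_self] at h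
  -- the minima do not feel the hair of `y` when `y ∈ W`
  have hinf : ∀ (t' : unitInterval) (W : Finset (Fin n)), y ∈ W →
      A.inf' hA (fun a' => (prodBernoulli (Function.update u e t')).real (openConnIn ((↑W : Set (Fin n))ᶜ) a' b)) =
        A.inf' hA (fun a' => μ0.real (openConnIn ((↑W : Set (Fin n))ᶜ) a' b)) := by
    intro t' W hyW
    refine Finset.inf'_congr hA rfl fun a' _ => ?_
    rw [hμ0]
    exact real_update_eq_of_preimage_insert_eq u e _ (preimage_insert_openConnIn_eq W y q a' b hyW) t'
  -- the pockets missing `y` are null: `s(x,y)` is sure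
  have hcl0 : ∀ (t' : unitInterval) (W : Finset (Fin n)), y ∉ W →
      (prodBernoulli (Function.update u e t')).real (clusterIs x W) = 0 := by
    intro t' W hyW
    have h1 : Function.update u e t' s(x, y) = 1 := by rw [Function.update_of_ne hexy, hsure]
    have h2 : Function.update (Function.update u e t') s(x, y) 1 = Function.update u e t' := by
      rw [← h1]; exact Function.update_eq_self _ _
    rw [← h2]
    exact real_clusterIs_update_one_eq_zero (Function.update u e t') x y hxy W hyW
  have hsum : ∀ t' : unitInterval,
      ∑ W ∈ nullSets A, (prodBernoulli (Function.update u e t')).real (clusterIs x W) *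
          A.inf' hA (fun a' => (prodBernoulli (Function.update u e t')).real (openConnIn ((↑W : Set (Fin n))ᶜ) a' b)) =
        ∑ W ∈ nullSets A, ((1 - (t' : ℝ)) * μ0.real (clusterIs x W) + (t' : ℝ) * μ1.real (clusterIs x W)) *
          A.inf' hA (fun a' => μ0.real (openConnIn ((↑W : Set (Fin n))ᶜ) a' b)) := by
    intro t'
    refine Finset.sum_congr rfl fun W _ => ?_
    by_cases hyW : y ∈ W
    · rw [hdec t', hinf t' W hyW]
    · rw [hcl0 t' W hyW]
      have h0 : μ0.real (clusterIs x W) = 0 := by rw [hμ0]; exact hcl0 0 W hyW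
      have h1 : μ1.real (clusterIs x W) = 0 := by rw [hμ1]; exact hcl0 1 W hyW
      rw [h0, h1]; ring
  have hsplit : ∀ t' : unitInterval,
      ∑ W ∈ nullSets A, ((1 - (t' : ℝ)) * μ0.real (clusterIs x W) + (t' : ℝ) * μ1.real (clusterIs x W)) *
          A.inf' hA (fun a' => μ0.real (openConnIn ((↑W : Set (Fin n))ᶜ) a' b)) =
        (1 - (t' : ℝ)) * ∑ W ∈ nullSets A, μ0.real (clusterIs x W) *
            A.inf' hA (fun a' => μ0.real (openConnIn ((↑W : Set (Fin n))ᶜ) a' b)) +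
          (t' : ℝ) * ∑ W ∈ nullSets A, μ1.real (clusterIs x W) *
            A.inf' hA (fun a' => μ0.real (openConnIn ((↑W : Set (Fin n))ᶜ) a' b)) := by
    intro t'
    rw [Finset.mul_sum, Finset.mul_sum, ← Finset.sum_add_distrib]
    exact Finset.sum_congr rfl fun W _ => by ring
  rw [hsum t, hsum 0, hsum 1, hsplit t, hsplit 0, hsplit 1, hdec t (openConn x b), hdec t (openConn j b),
    hdec 0 (openConn x b), hdec 0 (openConn j b), hdec 1 (openConn x b), hdec 1 (openConn j b)]
  have h0 : ((0 : unitInterval) : ℝ) = 0 := rfl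
  have h1 : ((1 : unitInterval) : ℝ) = 1 := rfl
  rw [h0, h1]
  ring

end KNGoodGC3

end Summit.CriticalPhenomena.PercolationContinuityZ3.Theorems

end
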